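import Summits.QuantumFields.BalabanUV.T4Continuum.Support.NE7StraightTowerCurlEnergyD4
import Summits.QuantumFields.BalabanUV.T4Continuum.Support.NE7TangentTransportGauge
import Summits.QuantumFields.BalabanUV.T4Continuum.Support.NE3EnergyHessBilin
import HarnessLib

/-!
# NE7FrameCorrectedCurlEnergyTower — THE FRAME-CORRECTED COARSE MAXWELL ENERGY OF THE k-FOLD LINEARISED AVERAGE, AND ITS CHART DICTIONARY:
# `curl_{V₀}(D𝒬^{(j+1)}_U Y)(P) = curl_{V₀}(Q̄^{(j+1)}_U Y)(P) + (G(z) − Ad_{V₀(∂P)} G(z))`, `G = framePotW` the accumulated linearised frames — so F5's j-uniform letter reads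
# `√(Σ_P ‖curl_{V₀} ṽ(P) − (G(z) − Ad_{V₀(∂P)}G(z))‖²_{HS∕n}) ≤ √(Σ_p ‖curl_U X̃(p)‖²) + 6·eC·ε·L^{−(j+1)}·√(Σ_b ‖X̃(b)‖²)` for `ṽ = (levelQ' L N j U X)̃`, IN d = 4, UNIFORMLY IN j, N
# (lineage `b2b-balaban-t4-ne7-p1`, gen 117, file F6; ROAD-G116 §7∕§9 (G1))

Cell `pub-balaban`, rung (B)+1 sub-cell t4, CRUX PROVER NE7 #1 (OWNER of row NE7), generation 117.  §1 the identity (✓ `NE3TangentCovariantTower.dirIter_eq_QbarIter_add_gaugeDir` + ✓ `curlAt_add` +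
✓ `curlAt_gaugeDir`): the dressed curl of the full linearised k-fold average differs from that of its STRAIGHT part by the EXACT plaquette commutator of the accumulated frame generator;
§2 the frame-corrected form of F5's headline; §3 the CHART DICTIONARY `(levelQ' L N j U X)̃ = dirIter L (j+1) U X̃` for skew torus fields (the road's constraint differential IS the torus
reading of `dirIter`; proved here by the tower induction over ✓ `fderiv_coord_resDir`, ✓ `cpush_skew`, ✓ `isPeriodicDir_cpush`, ✓ `chartDir_id_resDir` — the sibling
`NE7MultiplierOfRightInverse.coe_levelQ'_resDir` states the `resDir`∕`skewPF` form); §4 the headline in the road's chart currency.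
WHY THE FRAME CORRECTION IS NECESSARY (memo `t4/b2b-balaban-t4-ne7-p1-g117/ROAD-G117.md` §2): for a corner-charge gauge direction `X̃ = gaugeDir_U(φ·1_{corners})` the coarse field is the
O(1) coarse gauge direction of the sampled charges, whose dressed curl at a curved `V₀` is `O(ε)·|φ|` per plaquette, while the fine energy and the SCALED fine mass are `O(ε²L^{−4(j+1)})`,
`O(L^{−2(j+1)})` per charge — no j-uniform bound of the uncorrected coarse curl energy by fine energy + scaled mass exists.
HONEST FRAMING: lattice kinematics; constants not optimised; nothing of Bałaban's asserted ((48), (110)–(120) context only); NOT (G′) (no slice, no multiplier term, no Hessian), NOT NE7 as a spine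
node, NOT NE3; spine 0∕9; finite T⁴ rung (B)+1 — NOT infinite volume, NOT mass gap, NOT BetaPertH, NOT Clay.
-/

set_option autoImplicit false

open scoped BigOperators Matrix.Norms.L2Operator
open NormedSpace Finset

namespace Summit.QuantumFields.BalabanUV.T4Continuum.NE7FrameCorrectedCurlEnergyTower

open Literature.MathematicalPhysics.QuantumFieldTheory.Balaban1983to89
open B7Prop1Explicit B7Prop2Explicit MatrixLog UnitaryModel
open T4AveragingDeficitWall (IsUnitaryCfg IsSkewDir SmallField Ad curl curlAt)
open T4AveragingDeficitWallBoundary (IsPeriodicCfg periodBox)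
open AveragingDeficitPeriodicCounting (IsPeriodicDir)
open AveragingDeficitTorusChart (TDir resDir chartDir chartDir_id_resDir isPeriodicDir_chartDir)
open AveragingDeficitChartCalculus (cavg coord)
open AveragingDeficitTwoLevelPrep (twoLevelSmall prop1Radius skewSub skewPF skewPR skewPF_of_mem mem_skewSub)
open AveragingDeficitMultiLevelPrep (cavgIter cpush tower levelQ' LevelSmall natCast_tower_succ tower_ne_zero fderiv_coord_resDir ball_of_small isPeriodicDir_cpush)
open AveragingDeficitFermat (isPeriodicCfg_cavg)
open MatrixNorms (nhsNormSq)
open MinimalActionLevels (perWin)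
open BlockAveragePushDirGauge (gaugeDir)
open NE3TangentCovariantTower (dirIter QbarIter framePotW dirIter_one dirIter_succ step_small dirIter_eq_QbarIter_add_gaugeDir)
open NE3CurlOfGaugeDir (curlAt_gaugeDir)
open NE3EnergyHessBilin (curlAt_add)
open NE3QuadRemainderTower (cpush_skew)
open NE7RadIterUniform (radD levelSmall_of_class_radius)
open NE7StraightTowerCurlEnergy (eC mC)
open NE7StraightTowerCurlEnergyD4 (sqrt_curl_energy_QbarIter_le_class_d4)
open NE7FlatAverageCurlCommutation (isSkewDir_chartDir_id)

noncomputable section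

variable {d : ℕ} {n : Type*} [Fintype n] [DecidableEq n]

/-! ## §1 The dressed curl of the full linearised average = that of the straight part + the frame commutator -/

/-- **THE FRAME COMMUTATOR** of the accumulated linearised frames `G = framePotW L (j+1) W Y` at the top background `V₀ = cavgIter L (j+1) W`:
`frameComm L j W Y z μ ν := G z − Ad_{V₀(∂P(z;μ,ν))} (G z)` — the exact dressed curl of the coarse gauge direction generated by `G` (✓ `curlAt_gaugeDir`). [folklore] -/
def frameComm (L : ℕ) (j : ℕ) (W : Site d → Fin d → (Matrix n n ℂ)ˣ) (Y : Site d → Fin d → Matrix n n ℂ) (z : Site d) (μ ν : Fin d) : Matrix n n ℂ :=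
  framePotW L (j + 1) W Y z - Ad (hol (cavgIter L (j + 1) W) z (plaqWord μ ν)) (framePotW L (j + 1) W Y z)

/-- **THE DRESSED CURL OF THE k-FOLD LINEARISED AVERAGE SPLITS** (tower class: `W` unitary `(tower L M (j+1))`-periodic, `0 ≤ x`, `LevelSmall d L j x`, `SmallField W x`; `Y` skew and
`(tower L M (j+1))`-periodic): `curlAt V₀ (dirIter L (j+1) W Y) z μ ν = curlAt V₀ (QbarIter L (j+1) W Y) z μ ν + frameComm L j W Y z μ ν`, `V₀ = cavgIter L (j+1) W`.
[cite: Balaban1985Averaging, (110)–(120) pp.31–35] -/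
theorem curlAt_dirIter_eq [Nonempty n] {L M : ℕ} [NeZero M] (hL : 1 ≤ L) (j : ℕ) {W : Site d → Fin d → (Matrix n n ℂ)ˣ} {x : ℝ}
    (hWu : IsUnitaryCfg W) (hWP : IsPeriodicCfg W ((tower L M (j + 1) : ℕ) : ℤ)) (hx : 0 ≤ x) (hs : LevelSmall d L j x) (hWx : SmallField W x)
    {Y : Site d → Fin d → Matrix n n ℂ} (hY : IsSkewDir Y) (hYP : IsPeriodicDir Y ((tower L M (j + 1) : ℕ) : ℤ)) (z : Site d) (μ ν : Fin d) :
    curlAt (cavgIter L (j + 1) W) (dirIter L (j + 1) W Y) z μ ν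
      = curlAt (cavgIter L (j + 1) W) (QbarIter L (j + 1) W Y) z μ ν + frameComm L j W Y z μ ν := by
  have hsplit := dirIter_eq_QbarIter_add_gaugeDir (M := M) hL j hWu hWP hx hs hWx hY hYP
  have hfun : dirIter L (j + 1) W Y = QbarIter L (j + 1) W Y + gaugeDir (cavgIter L (j + 1) W) (framePotW L (j + 1) W Y) := by
    rw [hsplit]; rfl
  rw [hfun, curlAt_add, curlAt_gaugeDir]
  rfl

/-! ## §2 The frame-corrected headline in d = 4 (plain fields) -/

/-- **FRAME-CORRECTED COARSE MAXWELL ENERGY OF THE k-FOLD LINEARISED AVERAGE, d = 4, j-UNIFORM** (hypotheses of ✓ `sqrt_curl_energy_QbarIter_le_class_d4` plus `Y` skew):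
`√(Σ_{P∈perWin N} nhsNormSq (curl V₀ (dirIter L (j+1) U Y) P − frameComm L j U Y P)) ≤ √(Σ_p nhsNormSq (curl U Y p)) + 6·eC 4 L ν·ε·(L⁻¹)^{j+1}·√(Σ_b Σ_κ nhsNormSq (Y b κ))`.
[cite: Balaban1985Averaging, (48) p.25, (120) p.35] -/
theorem sqrt_frameCorrected_curl_energy_le_class_d4 [Nonempty n] {L N : ℕ} [NeZero L] [NeZero N] (hL : 2 ≤ L) (hN : 1 ≤ N) {ε : ℝ} (hε : 0 ≤ ε)
    (hεD : 4 * ε * radD 4 L * (((L : ℝ) ^ 2)⁻¹) ^ 2 ≤ 1) (hεT : twoLevelSmall 4 L * (2 * ε * ((L : ℝ) ^ 2)⁻¹) ≤ 1)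
    (hεM : 8 * (L : ℝ) * mC 4 L (Fintype.card n) * ε * ((L : ℝ) ^ 2)⁻¹ ≤ 1) (j : ℕ)
    {U : Site 4 → Fin 4 → (Matrix n n ℂ)ˣ} (hU : IsUnitaryCfg U) (hUP : IsPeriodicCfg U ((tower L N (j + 1) : ℕ) : ℤ))
    (hUx : SmallField U (ε * (((L : ℝ) ^ 2)⁻¹) ^ (j + 1)))
    {Y : Site 4 → Fin 4 → Matrix n n ℂ} (hY : IsSkewDir Y) (hYP : IsPeriodicDir Y ((tower L N (j + 1) : ℕ) : ℤ)) :
    Real.sqrt (∑ P ∈ perWin 4 N, nhsNormSq (curl (cavgIter L (j + 1) U) (dirIter L (j + 1) U Y) P - frameComm L j U Y P.1 P.2.1.1 P.2.1.2))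
      ≤ Real.sqrt (∑ p ∈ perWin 4 (tower L N (j + 1)), nhsNormSq (curl U Y p))
        + 6 * eC 4 L (Fintype.card n) * ε * ((L : ℝ)⁻¹) ^ (j + 1) * Real.sqrt (∑ b ∈ periodBox (tower L N (j + 1)), ∑ κ : Fin 4, nhsNormSq (Y b κ)) := by
  have hL1 : 1 ≤ L := by omega
  have hx0 : 0 ≤ ε * (((L : ℝ) ^ 2)⁻¹) ^ (j + 1) := by positivity
  obtain ⟨hsm, -⟩ := levelSmall_of_class_radius (d := 4) hL hε hεD hεT j
  have h := sqrt_curl_energy_QbarIter_le_class_d4 hL hN hε hεD hεT hεM j hU hUP hUx hYP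
  have heq : ∀ P ∈ perWin 4 N, nhsNormSq (curl (cavgIter L (j + 1) U) (dirIter L (j + 1) U Y) P - frameComm L j U Y P.1 P.2.1.1 P.2.1.2)
      = nhsNormSq (curl (cavgIter L (j + 1) U) (QbarIter L (j + 1) U Y) P) := by
    intro P _
    rw [show curl (cavgIter L (j + 1) U) (dirIter L (j + 1) U Y) P = curlAt (cavgIter L (j + 1) U) (dirIter L (j + 1) U Y) P.1 P.2.1.1 P.2.1.2 from rfl,
      curlAt_dirIter_eq (M := N) hL1 j hU hUP hx0 hsm hUx hY hYP, add_sub_cancel_right]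
    rfl
  rw [Finset.sum_congr rfl heq]
  exact h

/-! ## §3 The chart dictionary: the road's constraint differential is the torus reading of `dirIter` -/

/-- **`(levelQ' L N j W X)̃ = dirIter L (j+1) W X̃`** for every skew torus field `X` (tower class at the base `W`: unitary, `(L·tower L N j)`-periodic, `0 ≤ x`, `LevelSmall d L j x`,
`SmallField W x`); `̃ = chartDir id`. [folklore] -/
theorem chartDir_levelQ'_eq_dirIter [Nonempty n] {L N : ℕ} [NeZero L] [NeZero N] (hL : 1 ≤ L) :
    ∀ (j : ℕ) {W : Site d → Fin d → (Matrix n n ℂ)ˣ} {x : ℝ}, IsUnitaryCfg W → IsPeriodicCfg W ((L : ℤ) * (tower L N j : ℕ)) → 0 ≤ x →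
    LevelSmall d L j x → SmallField W x → ∀ {X : TDir d n (L * tower L N j)}, X ∈ skewSub d n (L * tower L N j) →
      chartDir (ContinuousLinearMap.id ℝ (Matrix n n ℂ)) N ((levelQ' L N j W X : ↥(skewSub d n N)) : TDir d n N)
        = dirIter L (j + 1) W (chartDir (ContinuousLinearMap.id ℝ (Matrix n n ℂ)) (L * tower L N j) X) := by
  intro j
  induction j with
  | zero =>
      intro W x hWu hWP hx hs hWx X hX
      set φ := chartDir (ContinuousLinearMap.id ℝ (Matrix n n ℂ)) (L * tower L N 0) X with hφ
      have hφP : IsPeriodicDir φ ((L * tower L N 0 : ℕ) : ℤ) := isPeriodicDir_chartDir _ _ X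
      have e : ((L * tower L N 0 : ℕ) : ℤ) = (L : ℤ) * N := by simp [tower]
      have hφP' : IsPeriodicDir φ ((L : ℤ) * N) := by rw [← e]; exact hφP
      have hφs : IsSkewDir φ := isSkewDir_chartDir_id hX
      obtain ⟨h512, -, -, -⟩ := step_small hL hWu hx hs hWx
      have hXφ : X = resDir (L * N) φ := by
        funext r κ
        exact (congrArg (fun s => X s κ) (AveragingDeficitTorusChart.redN_boxVec (L * N) r)).symm
      have hφP0 : IsPeriodicDir φ ((L * N : ℕ) : ℤ) := hφP
      have hval : ((levelQ' L N 0 W X : ↥(skewSub d n N)) : TDir d n N)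
          = skewPF N ((fderiv ℝ (coord (ContinuousLinearMap.id ℝ (Matrix n n ℂ)) L N W) 0) (resDir (L * N) φ)) := by
        rw [← hXφ]; rfl
      have hcs : IsSkewDir (cpush L W φ) := cpush_skew hL hWu hx h512 hWx hφs
      have hcP : IsPeriodicDir (cpush L W φ) (N : ℤ) := isPeriodicDir_cpush L N hWP hφP'
      have hmem : resDir N (cpush L W φ) ∈ skewSub d n N := mem_skewSub.mpr fun _ _ => hcs _ _
      rw [hval, fderiv_coord_resDir (N := N) (ball_of_small hL hWu hx hs hWx) hφP0, skewPF_of_mem hmem, chartDir_id_resDir N hcP,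
        zero_add, dirIter_one]
  | succ j ih =>
      intro W x hWu hWP hx hs hWx X hX
      set φ := chartDir (ContinuousLinearMap.id ℝ (Matrix n n ℂ)) (L * tower L N (j + 1)) X with hφ
      have hφP : IsPeriodicDir φ ((L * tower L N (j + 1) : ℕ) : ℤ) := isPeriodicDir_chartDir _ _ X
      have hφs : IsSkewDir φ := isSkewDir_chartDir_id hX
      obtain ⟨h512, hcu, hr0, hcx⟩ := step_small hL hWu hx hs.1 hWx
      have hXφ : X = resDir (L * (L * tower L N j)) φ := by
        funext r κ
        exact (congrArg (fun s => X s κ) (AveragingDeficitTorusChart.redN_boxVec (L * (L * tower L N j)) r)).symm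
      have hφP2 : IsPeriodicDir φ ((L * (L * tower L N j) : ℕ) : ℤ) := hφP
      -- periods
      have eT : ((L * tower L N (j + 1) : ℕ) : ℤ) = (L : ℤ) * (L * tower L N j : ℕ) := by simp only [tower]; push_cast; ring
      have hφP' : IsPeriodicDir φ ((L : ℤ) * (L * tower L N j : ℕ)) := by rw [← eT]; exact hφP
      have hWP' : IsPeriodicCfg (cavg L W) ((L : ℤ) * (tower L N j : ℕ)) := by
        have h := isPeriodicCfg_cavg L (tower L N (j + 1)) hWP
        rw [natCast_tower_succ] at h
        exact h
      have hcs : IsSkewDir (cpush L W φ) := cpush_skew hL hWu hx h512 hWx hφs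
      have hcP : IsPeriodicDir (cpush L W φ) ((L * tower L N j : ℕ) : ℤ) := isPeriodicDir_cpush L _ hWP hφP'
      have hmem : resDir (L * tower L N j) (cpush L W φ) ∈ skewSub d n (L * tower L N j) := mem_skewSub.mpr fun _ _ => hcs _ _
      have hval : ((levelQ' L N (j + 1) W X : ↥(skewSub d n N)) : TDir d n N)
          = ((levelQ' L N j (cavg L W) ((fderiv ℝ (coord (ContinuousLinearMap.id ℝ (Matrix n n ℂ)) L (L * tower L N j) W) 0) (resDir (L * (L * tower L N j)) φ)) : ↥(skewSub d n N)) : TDir d n N) := by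
        rw [← hXφ]; rfl
      rw [hval, fderiv_coord_resDir (N := L * tower L N j) (ball_of_small hL hWu hx hs.1 hWx) hφP2, ih hcu hWP' hr0 hs.2 hcx hmem,
        chartDir_id_resDir _ hcP]
      exact (dirIter_succ L (j + 1) W φ).symm

/-! ## §4 The headline in the road's chart currency -/

/-- **FRAME-CORRECTED COARSE MAXWELL ENERGY OF THE CONSTRAINT DIFFERENTIAL, d = 4, j-UNIFORM**: for `L ≥ 2`, `N ≥ 1`, `0 ≤ ε` under the three smallness lines (depending on `L` and `card n`
only), every unitary `(tower L N (j+1))`-periodic `U` with `SmallField U (ε·L^{−2(j+1)})` (e.g. a class configuration `U ∈ sfClass 4 L N ε (j+1)`), every skew fine torus field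
`X ∈ skewSub 4 n (L·tower L N j)`, with `X̃ = chartDir id X`, `v = levelQ' L N j U X`, `ṽ = chartDir id N ↑v`, `V₀ = cavgIter L (j+1) U`:
`√(Σ_{P∈perWin N} nhsNormSq (curl V₀ ṽ P − frameComm L j U X̃ P)) ≤ √(Σ_{p∈perWin (tower L N (j+1))} nhsNormSq (curl U X̃ p)) + 6·eC 4 L ν·ε·(L⁻¹)^{j+1}·√(Σ_{b∈periodBox (tower L N (j+1))} Σ_κ nhsNormSq (X̃ b κ))`.
[cite: Balaban1985Averaging, (48) p.25, (120) p.35] -/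
theorem sqrt_frameCorrected_curl_energy_levelQ'_le [Nonempty n] {L N : ℕ} [NeZero L] [NeZero N] (hL : 2 ≤ L) (hN : 1 ≤ N) {ε : ℝ} (hε : 0 ≤ ε)
    (hεD : 4 * ε * radD 4 L * (((L : ℝ) ^ 2)⁻¹) ^ 2 ≤ 1) (hεT : twoLevelSmall 4 L * (2 * ε * ((L : ℝ) ^ 2)⁻¹) ≤ 1)
    (hεM : 8 * (L : ℝ) * mC 4 L (Fintype.card n) * ε * ((L : ℝ) ^ 2)⁻¹ ≤ 1) (j : ℕ)
    {U : Site 4 → Fin 4 → (Matrix n n ℂ)ˣ} (hU : IsUnitaryCfg U) (hUP : IsPeriodicCfg U ((tower L N (j + 1) : ℕ) : ℤ))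
    (hUx : SmallField U (ε * (((L : ℝ) ^ 2)⁻¹) ^ (j + 1)))
    {X : TDir 4 n (L * tower L N j)} (hX : X ∈ skewSub 4 n (L * tower L N j)) :
    Real.sqrt (∑ P ∈ perWin 4 N, nhsNormSq
        (curl (cavgIter L (j + 1) U) (chartDir (ContinuousLinearMap.id ℝ (Matrix n n ℂ)) N ((levelQ' L N j U X : ↥(skewSub 4 n N)) : TDir 4 n N)) P
          - frameComm L j U (chartDir (ContinuousLinearMap.id ℝ (Matrix n n ℂ)) (L * tower L N j) X) P.1 P.2.1.1 P.2.1.2))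
      ≤ Real.sqrt (∑ p ∈ perWin 4 (tower L N (j + 1)), nhsNormSq (curl U (chartDir (ContinuousLinearMap.id ℝ (Matrix n n ℂ)) (L * tower L N j) X) p))
        + 6 * eC 4 L (Fintype.card n) * ε * ((L : ℝ)⁻¹) ^ (j + 1)
          * Real.sqrt (∑ b ∈ periodBox (tower L N (j + 1)), ∑ κ : Fin 4, nhsNormSq (chartDir (ContinuousLinearMap.id ℝ (Matrix n n ℂ)) (L * tower L N j) X b κ)) := by
  have hL1 : 1 ≤ L := by omega
  have hx0 : 0 ≤ ε * (((L : ℝ) ^ 2)⁻¹) ^ (j + 1) := by positivity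
  obtain ⟨hsm, -⟩ := levelSmall_of_class_radius (d := 4) hL hε hεD hεT j
  have hUP' : IsPeriodicCfg U ((L : ℤ) * (tower L N j : ℕ)) := by rw [← natCast_tower_succ]; exact hUP
  set Xt := chartDir (ContinuousLinearMap.id ℝ (Matrix n n ℂ)) (L * tower L N j) X with hXt
  have hXtP : IsPeriodicDir Xt ((tower L N (j + 1) : ℕ) : ℤ) := by
    have h := isPeriodicDir_chartDir (ContinuousLinearMap.id ℝ (Matrix n n ℂ)) (L * tower L N j) X
    have e : ((L * tower L N j : ℕ) : ℤ) = ((tower L N (j + 1) : ℕ) : ℤ) := rfl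
    rw [e] at h; exact h
  have hXts : IsSkewDir Xt := isSkewDir_chartDir_id hX
  rw [chartDir_levelQ'_eq_dirIter hL1 j hU hUP' hx0 hsm hUx hX]
  exact sqrt_frameCorrected_curl_energy_le_class_d4 hL hN hε hεD hεT hεM j hU hUP hUx hXts hXtP

end

end Summit.QuantumFields.BalabanUV.T4Continuum.NE7FrameCorrectedCurlEnergyTower
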